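import Summits.ValiantsHypothesis.ValiantsHypothesis.Theorems.LacunarySymmetroidMatrixDescartesTailGraft

/-!
# `MatrixDescartes` — THE TAIL GRAFT (m = 2), BOTTOM END and the two-ended corollary

PORT (val-lit-p4 g11, 2026-08-28, desk RULINGS #128/#133), part 2 of 2: §4 of the ideator file
`Cruxes/MatrixDescartes/Lines/tail_graft.lean` (val-idea-5 g2, @dab88cbb8b0c, sorry-free, no definitions) moved VERBATIM into
`Theorems/` (namespace `…Theorems.LacunarySymmetroidMatrixDescartes.TailGraft`; §§1–3 are
`Theorems/LacunarySymmetroidMatrixDescartesTailGraft.lean`).  Proofs unchanged.  Helper mode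
(`--supports stmt-ValiantsHypothesis-18050 --as helper`).

CONTENT.  The mirror of the top-end graft at `x → 0⁺` (`tendsto_pow_div_bottom`, `tendsto_inv_pow_smul_pencil_bottom`,
`exists_alternating_tail_bottom`: a rank-one BOTTOM letter is worth one more alternation at the same format) and the two-ended
corollary `not_posRootLawAt_of_tail_both`: **rank-one ENDS are worth `+2` at the same format** — an `N`-alternation certificate on a
`(2, K+1)` pencil with both end letters of rank exactly one refutes `PosRootLawAt 2 (K+1) (N+1)`.  For general `m` an end letter of
corank `c` should be worth `+c` (not typed here).  CONTRAPOSITIVE READING for constrained sub-censuses: pencils with EXACTLY rank-one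
end letters stay at least 2 below the alternation record of their format.

HONEST FRAMING (from the source).  LOWER-bound / construction mathematics in census currency for the crux
`Theses.LacunarySymmetroid.MatrixDescartes` (stmt-ValiantsHypothesis-18050); it proves NOTHING about the crux (an upper-bound
statement), nothing about `DoorA26` / `DoorA34`, nothing about `VP ≠ VNP`.  No `sorry`, no new definition.  [folklore]
-/

set_option linter.dupNamespace false

namespace Summit.ValiantsHypothesis.ValiantsHypothesis.Theorems.LacunarySymmetroidMatrixDescartes.TailGraft

open Matrix Finset Filter Topology
open Summit.ValiantsHypothesis.ValiantsHypothesis.Theorems.LacunarySymmetroidMatrixDescartes.Census.Graft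

/-! ## 4. The tail graft at the bottom end (mirror: `x → 0⁺`) -/

/-- For `x → 0⁺`, `x^(d l) / x^(d 0) → [l = 0]` when `d` is strictly increasing. [folklore] -/
theorem tendsto_pow_div_bottom {K : ℕ} (d : Fin (K + 1) → ℕ) (hd : StrictMono d) (l : Fin (K + 1)) :
    Tendsto (fun x : ℝ => x ^ d l * (x ^ d 0)⁻¹) (𝓝[Set.Ioi 0] 0)
      (𝓝 (if l = 0 then (1 : ℝ) else 0)) := by
  by_cases hl : l = 0
  · subst hl
    simp only [if_true]
    refine tendsto_const_nhds.congr' ?_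
    filter_upwards [self_mem_nhdsWithin] with x hx
    rw [Set.mem_Ioi] at hx
    rw [mul_inv_cancel₀ (pow_ne_zero _ hx.ne')]
  · simp only [hl, if_false]
    have hlt : d 0 < d l := hd (lt_of_le_of_ne (Fin.zero_le l) (Ne.symm hl))
    have hk : d l - d 0 ≠ 0 := by omega
    have h0 : Tendsto (fun x : ℝ => x ^ (d l - d 0)) (𝓝[Set.Ioi 0] 0) (𝓝 0) := by
      have h := ((continuous_pow (d l - d 0)).tendsto (0 : ℝ))
      rw [zero_pow hk] at h
      exact h.mono_left nhdsWithin_le_nhds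
    refine h0.congr' ?_
    filter_upwards [self_mem_nhdsWithin] with x hx
    rw [Set.mem_Ioi] at hx
    rw [pow_sub₀ _ hx.ne' hlt.le]

/-- After division by `x^(d 0)` the pencil tends to its bottom letter as `x → 0⁺`. [folklore] -/
theorem tendsto_inv_pow_smul_pencil_bottom {K : ℕ} (d : Fin (K + 1) → ℕ) (hd : StrictMono d)
    (S : Fin (K + 1) → Matrix (Fin 2) (Fin 2) ℝ) :
    Tendsto (fun x : ℝ => (x ^ d 0)⁻¹ • ∑ l, x ^ d l • S l) (𝓝[Set.Ioi 0] 0) (𝓝 (S 0)) := by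
  have h : ∀ x : ℝ, (x ^ d 0)⁻¹ • (∑ l, x ^ d l • S l) = ∑ l, (x ^ d l * (x ^ d 0)⁻¹) • S l := by
    intro x
    rw [Finset.smul_sum]
    refine Finset.sum_congr rfl fun l _ => ?_
    rw [smul_smul, mul_comm]
  simp_rw [h]
  have hlim : S 0 = ∑ l, (if l = 0 then (1 : ℝ) else 0) • S l := by
    simp [ite_smul, Finset.sum_ite_eq']
  rw [hlim]
  exact tendsto_finsetSum _ fun l _ => (tendsto_pow_div_bottom d hd l).smul_const _

/-- **THE TAIL GRAFT (m = 2, bottom end).**  A rank-one BOTTOM letter is worth one more alternation at the same format: thicken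
`S 0` to `S 0 + s • 1`; the new test point is prepended below `τ 0`. [folklore] -/
theorem exists_alternating_tail_bottom {K N : ℕ} (d : Fin (K + 1) → ℕ) (S : Fin (K + 1) → Matrix (Fin 2) (Fin 2) ℝ)
    (hd : StrictMono d) (hS : ∀ l, (S l).IsSymm)
    (hdet : (S 0).det = 0) (hne0 : S 0 ≠ 0)
    (τ : Fin (N + 1) → ℝ) (hτ : StrictMono τ) (hpos : ∀ j, 0 < τ j)
    (hne : ∀ j, (∑ l, τ j ^ d l • S l).det ≠ 0)
    (halt : ∀ j : Fin N, (∑ l, τ j.castSucc ^ d l • S l).det * (∑ l, τ j.succ ^ d l • S l).det < 0) :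
    ∃ (s : ℝ) (τ' : Fin (N + 1 + 1) → ℝ),
      (∀ l, (Function.update S 0 (S 0 + s • (1 : Matrix (Fin 2) (Fin 2) ℝ)) l).IsSymm) ∧
      StrictMono τ' ∧ (∀ j, 0 < τ' j) ∧
      (∀ j, (∑ l, τ' j ^ d l • Function.update S 0 (S 0 + s • (1 : Matrix (Fin 2) (Fin 2) ℝ)) l).det ≠ 0) ∧
      ∀ j : Fin (N + 1),
        (∑ l, τ' j.castSucc ^ d l • Function.update S 0 (S 0 + s • (1 : Matrix (Fin 2) (Fin 2) ℝ)) l).det *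
        (∑ l, τ' j.succ ^ d l • Function.update S 0 (S 0 + s • (1 : Matrix (Fin 2) (Fin 2) ℝ)) l).det < 0 := by
  classical
  set J : Matrix (Fin 2) (Fin 2) ℝ := S 0 with hJ
  set D : ℕ := d 0 with hD
  set G : ℝ → Matrix (Fin 2) (Fin 2) ℝ := fun x => ∑ l, x ^ d l • S l with hG
  have hT : J.trace ≠ 0 := trace_ne_zero_of_det_eq_zero (hS _) hdet hne0
  set dN : ℝ := (G (τ 0)).det with hdN
  have hdN0 : dN ≠ 0 := hne 0
  have hGs : ∀ s x : ℝ, (∑ l, x ^ d l • Function.update S 0 (S 0 + s • (1 : Matrix (Fin 2) (Fin 2) ℝ)) l)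
      = G x + (s * x ^ D) • (1 : Matrix (Fin 2) (Fin 2) ℝ) := by
    intro s x
    rw [sum_smul_update_add, smul_smul, mul_comm]
  -- Step 1: small `t > 0`
  have hold : ∀ j : Fin (N + 1), ∀ᶠ t : ℝ in 𝓝 0,
      0 < (G (τ j) + ((-(t * (dN * J.trace))) * τ j ^ D) • (1 : Matrix (Fin 2) (Fin 2) ℝ)).det * (G (τ j)).det := by
    intro j
    have hsc : Continuous fun t : ℝ => (-(t * (dN * J.trace))) * τ j ^ D :=
      (continuous_id.mul continuous_const).neg.mul continuous_const
    have hc : Continuous fun t : ℝ => (G (τ j) + ((-(t * (dN * J.trace))) * τ j ^ D) • (1 : Matrix (Fin 2) (Fin 2) ℝ)).det :=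
      (continuous_const.add (hsc.smul continuous_const)).matrix_det
    have ht := hc.tendsto 0
    simp only [zero_mul, neg_zero, zero_smul, add_zero] at ht
    exact eventually_mul_pos_of_tendsto ht (hne j)
  have hone : ∀ᶠ t : ℝ in 𝓝 0, 0 < 1 - t * dN := by
    have hc : Tendsto (fun t : ℝ => 1 - t * dN) (𝓝 0) (𝓝 1) := by
      have h := (tendsto_const_nhds (x := (1 : ℝ)) (f := 𝓝 (0 : ℝ))).sub
        ((Filter.tendsto_id (x := 𝓝 (0 : ℝ))).mul (tendsto_const_nhds (x := dN)))
      simpa using h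
    have := eventually_mul_pos_of_tendsto hc one_ne_zero
    simpa using this
  obtain ⟨t, ⟨htall, ht1⟩, htpos⟩ :=
    ((((eventually_all.2 hold).and hone).filter_mono nhdsWithin_le_nhds).and
      (eventually_mem_nhdsWithin : ∀ᶠ t : ℝ in 𝓝[Set.Ioi 0] 0, t ∈ Set.Ioi 0)).exists
  rw [Set.mem_Ioi] at htpos
  set s : ℝ := -(t * (dN * J.trace)) with hs
  set L : ℝ := (J + s • (1 : Matrix (Fin 2) (Fin 2) ℝ)).det with hL
  have hLval : L = s * (s + J.trace) := by
    rw [hL, det_add_smul_one_two, hdet]; ring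
  have hLdN : L * dN < 0 := by
    rw [hLval, hs]
    have h1 : 0 < (dN * J.trace) * (dN * J.trace) := mul_self_pos.mpr (mul_ne_zero hdN0 hT)
    have key : 0 < t * ((dN * J.trace) * (dN * J.trace)) * (1 - t * dN) := mul_pos (mul_pos htpos h1) ht1
    have e : (-(t * (dN * J.trace))) * ((-(t * (dN * J.trace))) + J.trace) * dN
        = -(t * ((dN * J.trace) * (dN * J.trace)) * (1 - t * dN)) := by ring
    rw [e]; linarith
  have hL0 : L ≠ 0 := fun h => by rw [h, zero_mul] at hLdN; exact lt_irrefl 0 hLdN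
  -- Step 2: for this `s`, the sign of `det F_s(x)` as `x → 0⁺` is the sign of `L`
  have hlim : Tendsto (fun x : ℝ => ((x ^ D)⁻¹ • (G x + (s * x ^ D) • (1 : Matrix (Fin 2) (Fin 2) ℝ))).det)
      (𝓝[Set.Ioi 0] 0) (𝓝 L) := by
    have h1 : Tendsto (fun x : ℝ => (x ^ D)⁻¹ • G x + s • (1 : Matrix (Fin 2) (Fin 2) ℝ)) (𝓝[Set.Ioi 0] 0)
        (𝓝 (J + s • (1 : Matrix (Fin 2) (Fin 2) ℝ))) :=
      (tendsto_inv_pow_smul_pencil_bottom d hd S).add tendsto_const_nhds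
    have h2 := ((continuous_id.matrix_det).tendsto _).comp h1
    refine h2.congr' ?_
    filter_upwards [self_mem_nhdsWithin] with x hx
    rw [Set.mem_Ioi] at hx
    simp only [Function.comp, id]
    rw [smul_add, smul_smul, show (x ^ D)⁻¹ * (s * x ^ D) = s by field_simp]
  have hlt0 : ∀ᶠ x : ℝ in 𝓝[Set.Ioi 0] 0, x < τ 0 :=
    (eventually_lt_nhds (hpos 0)).filter_mono nhdsWithin_le_nhds
  obtain ⟨xs, ⟨hxsL, hxsN⟩, hxs0⟩ :=
    (((eventually_mul_pos_of_tendsto hlim hL0).and hlt0).and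
      (eventually_mem_nhdsWithin : ∀ᶠ x : ℝ in 𝓝[Set.Ioi 0] 0, x ∈ Set.Ioi 0)).exists
  rw [Set.mem_Ioi] at hxs0
  have hxsL' : 0 < (G xs + (s * xs ^ D) • (1 : Matrix (Fin 2) (Fin 2) ℝ)).det * L := by
    have hc : ((xs ^ D)⁻¹ • (G xs + (s * xs ^ D) • (1 : Matrix (Fin 2) (Fin 2) ℝ))).det
        = ((xs ^ D)⁻¹) ^ 2 * (G xs + (s * xs ^ D) • (1 : Matrix (Fin 2) (Fin 2) ℝ)).det := by
      rw [Matrix.det_smul, Fintype.card_fin]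
    rw [hc] at hxsL
    have hp : 0 < ((xs ^ D)⁻¹) ^ 2 := pow_pos (inv_pos.2 (pow_pos hxs0 _)) 2
    nlinarith [hxsL, hp, mul_pos hp hp]
  -- the new test points: `x⋆` prepended
  set τ' : Fin (N + 1 + 1) → ℝ := Fin.cons xs τ with hτ'
  have hτ's : ∀ j : Fin (N + 1), τ' j.succ = τ j := fun j => by simp [hτ']
  have hτ'0 : τ' 0 = xs := by simp [hτ']
  refine ⟨s, τ', ?_, ?_, ?_, ?_, ?_⟩
  · intro l
    by_cases hl : l = 0
    · subst hl
      rw [Function.update_self]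
      exact (hS _).add ((Matrix.isSymm_one).smul s)
    · rw [Function.update_of_ne hl]; exact hS l
  · refine Fin.strictMono_iff_lt_succ.mpr fun j => ?_
    rcases Fin.eq_zero_or_eq_succ j with rfl | ⟨i, rfl⟩
    · rw [Fin.castSucc_zero, hτ'0, hτ's]; exact hxsN
    · rw [show i.succ.castSucc = i.castSucc.succ from Fin.ext rfl, hτ's, hτ's]
      exact hτ (Fin.castSucc_lt_succ (i := i))
  · intro j
    rcases Fin.eq_zero_or_eq_succ j with rfl | ⟨i, rfl⟩
    · rw [hτ'0]; exact hxs0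
    · rw [hτ's]; exact hpos i
  · intro j
    rcases Fin.eq_zero_or_eq_succ j with rfl | ⟨i, rfl⟩
    · rw [hτ'0, hGs]
      intro h0
      rw [h0, zero_mul] at hxsL'
      exact lt_irrefl 0 hxsL'
    · rw [hτ's, hGs]
      intro h0
      have := htall i
      rw [h0, zero_mul] at this
      exact lt_irrefl 0 this
  · intro j
    rcases Fin.eq_zero_or_eq_succ j with rfl | ⟨i, rfl⟩
    · -- the new pair `(x⋆, τ 0)`
      rw [Fin.castSucc_zero, hτ'0, hτ's, hGs, hGs]
      exact mul_neg_of_carriers hxsL' (htall 0) hLdN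
    · rw [show i.succ.castSucc = i.castSucc.succ from Fin.ext rfl, hτ's, hτ's, hGs, hGs]
      exact mul_neg_of_carriers (htall i.castSucc) (htall i.succ) (halt i)

/-- **Census corollary (both ends).**  A `(2, K+1)` pencil whose bottom AND top letters have rank exactly one and which carries an
`N`-alternation certificate refutes `PosRootLawAt 2 (K+1) (N + 1)`: rank-one ENDS are worth `+2` at the same format.  (Needs `K ≥ 1`
so that the two end letters are distinct letters.) [folklore] -/
theorem not_posRootLawAt_of_tail_both {K N : ℕ} (hK : 1 ≤ K) (d : Fin (K + 1) → ℕ) (S : Fin (K + 1) → Matrix (Fin 2) (Fin 2) ℝ)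
    (hd : StrictMono d) (hS : ∀ l, (S l).IsSymm)
    (hdet0 : (S 0).det = 0) (hne00 : S 0 ≠ 0)
    (hdetl : (S (Fin.last K)).det = 0) (hne0l : S (Fin.last K) ≠ 0)
    (τ : Fin (N + 1) → ℝ) (hτ : StrictMono τ) (hpos : ∀ j, 0 < τ j)
    (hne : ∀ j, (∑ l, τ j ^ d l • S l).det ≠ 0)
    (halt : ∀ j : Fin N, (∑ l, τ j.castSucc ^ d l • S l).det * (∑ l, τ j.succ ^ d l • S l).det < 0) :
    ¬ Summit.ValiantsHypothesis.ValiantsHypothesis.Theorems.MatrixDescartes.Negative.PosRootLawAt 2 (K + 1) (N + 1) := by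
  have hl0 : (Fin.last K : Fin (K + 1)) ≠ 0 := by
    intro h
    have := congrArg Fin.val h
    simp at this
    omega
  -- thicken the bottom first
  obtain ⟨s, τ', hS', hτ', hpos', hne', halt'⟩ := exists_alternating_tail_bottom d S hd hS hdet0 hne00 τ hτ hpos hne halt
  set S' := Function.update S 0 (S 0 + s • (1 : Matrix (Fin 2) (Fin 2) ℝ)) with hS'd
  have htop : S' (Fin.last K) = S (Fin.last K) := by rw [hS'd, Function.update_of_ne hl0]
  -- then the top of the thickened pencil (its top letter is untouched)
  have h := not_posRootLawAt_of_tail_top d S' hd hS' (by rw [htop]; exact hdetl) (by rw [htop]; exact hne0l)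
    τ' hτ' hpos' hne' halt'
  simpa using h


end Summit.ValiantsHypothesis.ValiantsHypothesis.Theorems.LacunarySymmetroidMatrixDescartes.TailGraft
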